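import Literature.Analysis.FluidPDE.SelfSimilarCollapseAnsatz
import HarnessLib

/-!
# Gauge rigidity of the EXACT one-profile collapse ansatz with an ARBITRARY modulation `λ(t)`:
# no correction — logarithmic or otherwise — to Leray's parabolic gauge

Summit `NavierStokesRegularity`, cell topic directory `FluidComputer`, namespace
`…FluidComputer.SelfSimilarCensus` (kernel side of the `ns-blowup` self-similar census and of zone Z7
of the D-0081 profile search, «generalised self-similar with logarithmic correction»). Companion of
`SelfSimilarCollapseViscousRigidity.lean` / `DssScalingViscousRigidity.lean` (row (M16): exact POWER-LAW
self-similarity with `γ ≠ ½` forces a harmonic profile; their scope notes exclude «log-modulated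
self-similar blow-up (no exact covariance there)»). PROVED theorems only; no definitions, no named facts.

## The observation (folklore; Leray 1934 (3.11)–(3.12) is the case `λ(t) = (2a(T−t))^{-1/2}`)

`E` a finite-dimensional real inner product space, `U ∈ C¹(E; E)`, `P : E → ℝ`, `λ : ℝ → ℝ` ANY clock,
differentiable and non-vanishing on a set `S` of times. The one-profile (steady in similarity
variables) modulated ansatz is `u(t, x) = λ(t) • U(λ(t) • x) = nsRescaleData (λ t) U x`,
`p(t, x) = λ(t)² P(λ(t) • x)`. At `y = λ(t) x`, for EVERY `ν` (also `ν = 0`),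

  `∂ₜu + (u·∇)u + ∇p − νΔu = λ′(t) • (U + DU[y])(y) + λ(t)³ • ((U·∇)U + ∇P − νΔU)(y)`  (`momentum_nsRescaleData`):

every profile term carries `λ³` (velocity × length `= 1` is the Navier–Stokes coupling); only the
clock enters, through `λ′`. If the momentum equation holds on `S × E`, one linear-independence step
(`mul_eq_mul_of_twoTerm`) gives the DICHOTOMY `scalingGenerator_eq_zero_or_readout_eq`: either
`U + DU[y] ≡ 0` — and a `C¹` profile on ALL of `E` annihilated by the scaling generator VANISHES
(`eq_zero_of_scalingGenerator_eq_zero`; the Landau / `(−1)`-homogeneous branch lives on `E ∖ {0}`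
only) — or the readout `a := λ′/λ³` is CONSTANT on `S`; on an interval `λ⁻²` is then AFFINE
(`inv_sq_eq_of_readout_eq`), and with the blow-up time pinned (`λ → +∞` as `t ↑ T`) `a > 0` and
`λ(t) = (2a(T−t))^{-1/2}` exactly (`eq_lerayScale_of_readout_eq`), i.e. `u = lerayBackward a T U`.
HEADLINE (`modulatedCollapse_rigidity`, `sub_mul_sq_eq_const`, `exists_eq_lerayBackward`): **an exact
one-profile modulated collapse solving the Navier–Stokes (or Euler) momentum equation on
`(T₀, T) × E` and blowing up at `T` is trivial or has `(T − t) λ(t)² ≡ const` — NO correction to the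
parabolic gauge, logarithmic or otherwise, in any symmetry class, for any `ν`.** For zone Z7:
CENSUS-HOOKS H2 («Leray's gauge is the only gauge in which an exact fixed point of the renormalised
map is an object») holds for EVERY clock, not only power laws (`velocity_eq_const_of_dss_covariant`);
a «logarithmic correction» belongs to DRIFTING (similarity-time dependent) profiles only — the
DSS-side twin is `…Theorems.ModulationReadout.periodMean_readout_eq_half`.

## WHAT THIS IS NOT — and tree search

Not about profiles depending on the similarity time (DSS / drifting objects — Z7's actual search
space), not about asymptotic self-similarity, not a regularity theorem, not Navier–Stokes evidence.
The pressure ansatz is part of the hypothesis (as in every printed self-similar ansatz); the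
two-modulation ansatz `μ(t)U(λ(t)x)` with `μ/λ` non-constant is NOT treated.
`lean search 'modulat|rescaleData|homogeneous'`: `CriticalElement.modulatedSlice` (a definition),
`DynamicRescalingBKM` (Elgindi–Ghoul–Masmoudi's `λ`), `GavrilovSteadyEuler.steadyEuler_modulate`
(amplitude modulation of a steady Euler flow) — no gauge rigidity for a general clock. Tools: tree
`nsRescaleData`, `lerayBackward`, `convect_smul_comp_smul`, `gradient_sq_mul_comp_smul_sub`,
`laplacian_const_smul_comp_smul`; Mathlib `HasDerivAt.smul/.pow/.inv`, `is_const_of_deriv_eq_zero`,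
`constant_of_has_deriv_right_zero`, `tendsto_nhds_unique`, the `module` tactic.

## References

* J. Leray, Acta Math. 63 (1934) 193–248, §20, (3.11)–(3.12). [Leray1934]
* J. Nečas, M. Růžička, V. Šverák, Acta Math. 176 (1996) 283–294, Introduction. [NecasRuzickaSverak1996]
* T.-P. Tsai, Arch. Rational Mech. Anal. 143 (1998) 29–51, (1.1)–(1.3). [Tsai1998]
-/

noncomputable section

open Set Filter Topology InnerProductSpace
open scoped Laplacian RealInnerProductSpace

namespace Summit.NavierStokesRegularity.FluidComputer.SelfSimilarCensus

open Literature.Analysis.FluidPDE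

/-! ### §0 The linear-independence step behind the dichotomy -/

section TwoTerm

variable {F : Type*} [AddCommGroup F] [Module ℝ F] [NoZeroSMulDivisors ℝ F]

/-- **Two-term identities with a non-degenerate first slot are proportional**: if
`f(t) • W(y) + g(t) • N(y) = 0` for all `t ∈ S` and all `y`, and `W(y₀) ≠ 0`, then
`f(t) g(t′) = f(t′) g(t)` for `t, t′ ∈ S` (eliminate `N(y₀)`). [folklore] -/
theorem mul_eq_mul_of_twoTerm {Y : Type*} {S : Set ℝ} {f g : ℝ → ℝ} {W N : Y → F}
    (h : ∀ t ∈ S, ∀ y, f t • W y + g t • N y = 0) {y₀ : Y} (hy₀ : W y₀ ≠ 0)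
    {t t' : ℝ} (ht : t ∈ S) (ht' : t' ∈ S) : f t * g t' = f t' * g t := by
  have key : (f t * g t' - f t' * g t) • W y₀ = 0 := by
    have : (f t * g t' - f t' * g t) • W y₀ =
        g t' • (f t • W y₀ + g t • N y₀) - g t • (f t' • W y₀ + g t' • N y₀) := by module
    rw [this, h t ht y₀, h t' ht' y₀, smul_zero, smul_zero, sub_zero]
  exact sub_eq_zero.mp ((smul_eq_zero.mp key).resolve_right hy₀)

end TwoTerm

/-! ### §1 Calculus of the modulated slice `x ↦ λ(t) • U(λ(t) • x)` and the momentum identity -/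

section Calculus

variable {E : Type*} [NormedAddCommGroup E] [InnerProductSpace ℝ E] [FiniteDimensional ℝ E]
variable {U : E → E} {P : E → ℝ} {lam : ℝ → ℝ} {lam' t ν : ℝ}

omit [FiniteDimensional ℝ E] in
/-- **The time line of the modulated ansatz.** For `U ∈ C¹` and `λ` differentiable at `t` with
derivative `λ′`: `∂ₜ [λ(t) • U(λ(t) • x)] = λ′ • (U(y) + DU(y) y)`, `y = λ(t) • x` (for Leray's clock,
`λ′ = aλ³`, this is `hasDerivAt_lerayBackward_time`). [folklore] -/
theorem hasDerivAt_nsRescaleData_time (hlam : HasDerivAt lam lam' t) (hU : ContDiff ℝ 1 U) (x : E) :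
    HasDerivAt (fun s => nsRescaleData (lam s) U x)
      (lam' • (U (lam t • x) + fderiv ℝ U (lam t • x) (lam t • x))) t := by
  have h2 : HasDerivAt (fun s => U (lam s • x)) (fderiv ℝ U (lam t • x) (lam' • x)) t :=
    ((hU.differentiable one_ne_zero (lam t • x)).hasFDerivAt).comp_hasDerivAt t (hlam.smul_const x)
  have h3 := hlam.smul h2
  have he : (fun s => nsRescaleData (lam s) U x) = fun s => lam s • U (lam s • x) := rfl
  rw [he]
  refine h3.congr_deriv ?_
  simp only [map_smul]
  module

/-- The gradient of the pressure slice `x ↦ c² P(c • x)`: `c³ • (∇P)(c • x)`. [folklore] -/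
theorem gradient_sq_mul_comp_smul (P : E → ℝ) (c : ℝ) (x : E) :
    gradient (fun y => c ^ 2 * P (c • y)) x = c ^ 3 • gradient P (c • x) := by
  simpa only [sub_zero] using gradient_sq_mul_comp_smul_sub P c 0 x

/-- The Laplacian of the modulated slice: `Δ(c • U(c ·))(x) = c³ • (ΔU)(c • x)` for `c ≠ 0`
(no regularity needed: `laplacian_const_smul_comp_smul`). [folklore] -/
theorem laplacian_nsRescaleData {c : ℝ} (hc : c ≠ 0) (U : E → E) (x : E) :
    (Δ (nsRescaleData c U)) x = c ^ 3 • (Δ U) (c • x) := by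
  rw [show nsRescaleData c U = fun y => c • U (c • y) from rfl, laplacian_const_smul_comp_smul U c hc x,
    show c * c ^ 2 = c ^ 3 by ring]

omit [FiniteDimensional ℝ E] in
/-- The convection term of the modulated slice: `(u·∇)u (x) = c³ • ((U·∇)U)(c • x)`. [folklore] -/
theorem convect_nsRescaleData (c : ℝ) (U : E → E) (x : E) :
    convect (nsRescaleData c U) (nsRescaleData c U) x = c ^ 3 • convect U U (c • x) :=
  convect_smul_comp_smul U c x

/-- **The momentum operator on the modulated one-profile ansatz.** For `U ∈ C¹`, any `P`, any
`ν : ℝ`, `λ` differentiable at `t` with `λ(t) ≠ 0` and derivative `λ′`, with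
`u(s, x) = λ(s) • U(λ(s) • x)`, `p(s, x) = λ(s)² P(λ(s) • x)` and `y = λ(t) • x`:
`∂ₜu + (u·∇)u + ∇p − νΔu = λ′ • (U(y) + DU(y) y) + λ(t)³ • ((U·∇)U(y) + ∇P(y) − ν ΔU(y))`.
EVERY profile term — inertial, pressure AND viscous — carries the weight `λ³`; only the clock enters,
through `λ′` (for Leray's clock `λ′ = aλ³` the right side is `λ³ •` Leray's operator (3.11)). [folklore] -/
theorem momentum_nsRescaleData (hlam : HasDerivAt lam lam' t) (ht : lam t ≠ 0) (hU : ContDiff ℝ 1 U)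
    (P : E → ℝ) (ν : ℝ) (x : E) :
    timeDeriv (fun s => nsRescaleData (lam s) U) t x +
        convect (nsRescaleData (lam t) U) (nsRescaleData (lam t) U) x +
        gradient (fun y => lam t ^ 2 * P (lam t • y)) x -
        ν • (Δ (nsRescaleData (lam t) U)) x =
      lam' • (U (lam t • x) + fderiv ℝ U (lam t • x) (lam t • x)) +
        lam t ^ 3 • (convect U U (lam t • x) + gradient P (lam t • x) - ν • (Δ U) (lam t • x)) := by
  rw [timeDeriv_apply, (hasDerivAt_nsRescaleData_time hlam hU x).deriv, convect_nsRescaleData,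
    gradient_sq_mul_comp_smul, laplacian_nsRescaleData ht]
  module

end Calculus

/-! ### §2 The degenerate branch: a `C¹` profile annihilated by the scaling generator vanishes -/

section Generator

variable {E : Type*} [NormedAddCommGroup E] [NormedSpace ℝ E]
variable {F : Type*} [NormedAddCommGroup F] [NormedSpace ℝ F]

/-- **Euler's homogeneous-function theorem, degree `−1`, at the origin.** If `U : E → F` is `C¹` on
all of `E` and `U(y) + DU(y) y = 0` for every `y` (`U` is `(−1)`-homogeneous), then `U ≡ 0`: each
ray function `s ↦ s • U(s • y)` has derivative `U(sy) + DU(sy)(sy) = 0` and vanishes at `s = 0`.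
(On `E ∖ {0}` this fails — Landau's `(−1)`-homogeneous steady solutions — which is why the rigidity
theorem asks `U ∈ C¹(E)`.) [folklore] -/
theorem eq_zero_of_scalingGenerator_eq_zero {U : E → F} (hU : ContDiff ℝ 1 U)
    (h : ∀ y, U y + fderiv ℝ U y y = 0) : U = 0 := by
  funext y
  have hg : ∀ s : ℝ, HasDerivAt (fun s : ℝ => s • U (s • y)) (0 : F) s := by
    intro s
    have h1 : HasDerivAt (fun s : ℝ => s) 1 s := hasDerivAt_id s
    have h2 : HasDerivAt (fun s : ℝ => U (s • y)) (fderiv ℝ U (s • y) ((1 : ℝ) • y)) s :=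
      ((hU.differentiable one_ne_zero (s • y)).hasFDerivAt).comp_hasDerivAt s (h1.smul_const y)
    have h3 := h1.smul h2
    refine h3.congr_deriv ?_
    -- `s • DU(sy) (1 • y) + 1 • U(sy) = DU(sy)(s y) + U(sy) = 0`
    have hy := h (s • y)
    rw [map_smul] at hy
    rw [one_smul, one_smul, add_comm]
    exact hy
  have hdiff : Differentiable ℝ (fun s : ℝ => s • U (s • y)) := fun s => (hg s).differentiableAt
  have hconst := is_const_of_deriv_eq_zero hdiff (fun s => (hg s).deriv) 1 0
  simpa using hconst

end Generator

/-! ### §3 The dichotomy: degenerate profile or constant readout `λ′/λ³` -/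

section Rigidity

variable {E : Type*} [NormedAddCommGroup E] [InnerProductSpace ℝ E] [FiniteDimensional ℝ E]
variable {S : Set ℝ} {U : E → E} {P : E → ℝ} {lam lam' : ℝ → ℝ} {ν : ℝ}

/-! Standing hypotheses of §3: on the set of times `S` the clock `λ` is differentiable with
derivative `λ′` and non-vanishing, `U ∈ C¹(E; E)`, and the ansatz `u(t) = nsRescaleData (λ t) U`,
`p(t, x) = λ(t)² P(λ(t) x)` satisfies `∂ₜu + (u·∇)u + ∇p − νΔu = 0` at every point of `S × E`. -/
variable (hlam : ∀ t ∈ S, HasDerivAt lam (lam' t) t) (hne : ∀ t ∈ S, lam t ≠ 0)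
  (hU : ContDiff ℝ 1 U)
  (heq : ∀ t ∈ S, ∀ x : E,
    timeDeriv (fun s => nsRescaleData (lam s) U) t x +
        convect (nsRescaleData (lam t) U) (nsRescaleData (lam t) U) x +
        gradient (fun y => lam t ^ 2 * P (lam t • y)) x -
        ν • (Δ (nsRescaleData (lam t) U)) x = 0)
include hlam hne hU heq

/-- **From the momentum equation to the two-term identity**: for every `t ∈ S` and EVERY `y ∈ E`,
`λ′(t) • (U(y) + DU(y) y) + λ(t)³ • ((U·∇)U(y) + ∇P(y) − νΔU(y)) = 0`
(evaluate `momentum_nsRescaleData` at `x = λ(t)⁻¹ y`). [folklore] -/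
theorem twoTerm_of_momentum {t : ℝ} (ht : t ∈ S) (y : E) :
    lam' t • (U y + fderiv ℝ U y y) +
      lam t ^ 3 • (convect U U y + gradient P y - ν • (Δ U) y) = 0 := by
  have hx := heq t ht ((lam t)⁻¹ • y)
  rw [momentum_nsRescaleData (hlam t ht) (hne t ht) hU P ν, smul_smul, mul_inv_cancel₀ (hne t ht),
    one_smul] at hx
  exact hx

/-- **THE DICHOTOMY.** EITHER the profile is annihilated by the scaling generator,
`U(y) + DU(y) y = 0` for all `y`, OR the readout `λ′/λ³` takes ONE value on `S`:
`λ′(t)/λ(t)³ = λ′(t′)/λ(t′)³` for all `t, t′ ∈ S`. [folklore] -/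
theorem scalingGenerator_eq_zero_or_readout_eq :
    (∀ y, U y + fderiv ℝ U y y = 0) ∨
      ∀ t ∈ S, ∀ t' ∈ S, lam' t / lam t ^ 3 = lam' t' / lam t' ^ 3 := by
  by_cases hW : ∀ y, U y + fderiv ℝ U y y = 0
  · exact Or.inl hW
  · right
    push Not at hW
    obtain ⟨y₀, hy₀⟩ := hW
    intro t ht t' ht'
    rw [div_eq_div_iff (pow_ne_zero 3 (hne t ht)) (pow_ne_zero 3 (hne t' ht'))]
    exact mul_eq_mul_of_twoTerm (f := lam') (g := fun s => lam s ^ 3)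
      (fun s hs y => twoTerm_of_momentum hlam hne hU heq hs y) hy₀ ht ht'

/-- **Rigidity, readout form.** If `U ≢ 0`, the readout is constant: there is `a : ℝ` with
`λ′(t) = a λ(t)³` for every `t ∈ S` (the degenerate branch is excluded by
`eq_zero_of_scalingGenerator_eq_zero`). [folklore] -/
theorem exists_readout_eq_of_momentum (hU0 : U ≠ 0) :
    ∃ a : ℝ, ∀ t ∈ S, lam' t = a * lam t ^ 3 := by
  rcases scalingGenerator_eq_zero_or_readout_eq hlam hne hU heq with hW | hR
  · exact absurd (eq_zero_of_scalingGenerator_eq_zero hU hW) hU0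
  · rcases S.eq_empty_or_nonempty with hS | ⟨t₀, ht₀⟩
    · exact ⟨0, fun t ht => by simp [hS] at ht⟩
    · refine ⟨lam' t₀ / lam t₀ ^ 3, fun t ht => ?_⟩
      rw [← hR t ht t₀ ht₀, div_mul_cancel₀ _ (pow_ne_zero 3 (hne t ht))]

end Rigidity

/-! ### §4 The clock: a constant readout makes `λ⁻²` affine; a pinned blow-up makes it Leray's -/

section Clock

variable {S : Set ℝ} {lam lam' : ℝ → ℝ} {a T₀ T : ℝ}

/-- `d/dt (λ(t)²)⁻¹ = −2 λ′/λ³`; with the constant readout `λ′ = aλ³` this is `−2a`. [folklore] -/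
theorem hasDerivAt_inv_sq_of_readout_eq {t : ℝ} (hlam : HasDerivAt lam (lam' t) t) (hne : lam t ≠ 0)
    (ha : lam' t = a * lam t ^ 3) :
    HasDerivAt (fun s => (lam s ^ 2)⁻¹) (-2 * a) t := by
  have h1 : HasDerivAt (fun s => lam s ^ 2) ((2 : ℕ) * lam t ^ (2 - 1) * lam' t) t := hlam.pow 2
  have h2 := h1.inv (pow_ne_zero 2 hne)
  refine h2.congr_deriv ?_
  rw [ha]
  field_simp
  ring

/-- **Affine law.** On an order-connected set of times (an interval) on which `λ` is differentiable,
non-vanishing and has the constant readout `λ′ = aλ³`: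
`(λ(t)²)⁻¹ = (λ(t₀)²)⁻¹ − 2a(t − t₀)` for all `t, t₀ ∈ S`. [folklore] -/
theorem inv_sq_eq_of_readout_eq (hS : S.OrdConnected) (hlam : ∀ t ∈ S, HasDerivAt lam (lam' t) t)
    (hne : ∀ t ∈ S, lam t ≠ 0) (ha : ∀ t ∈ S, lam' t = a * lam t ^ 3) {t t₀ : ℝ} (ht : t ∈ S)
    (ht₀ : t₀ ∈ S) : (lam t ^ 2)⁻¹ = (lam t₀ ^ 2)⁻¹ - 2 * a * (t - t₀) := by
  have hφ' : ∀ s ∈ S, HasDerivAt (fun s => (lam s ^ 2)⁻¹ + 2 * a * s) 0 s := by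
    intro s hs
    have h1 := hasDerivAt_inv_sq_of_readout_eq (hlam s hs) (hne s hs) (ha s hs)
    have h2 : HasDerivAt (fun s : ℝ => 2 * a * s) (2 * a) s := by
      simpa using (hasDerivAt_id s).const_mul (2 * a)
    exact (h1.add h2).congr_deriv (by ring)
  have key : ∀ x y : ℝ, x ∈ S → y ∈ S → x ≤ y →
      (lam y ^ 2)⁻¹ + 2 * a * y = (lam x ^ 2)⁻¹ + 2 * a * x := by
    intro x y hx hy hxy
    have hsub : Icc x y ⊆ S := hS.out hx hy
    have hcont : ContinuousOn (fun s => (lam s ^ 2)⁻¹ + 2 * a * s) (Icc x y) :=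
      fun s hs => ((hφ' s (hsub hs)).continuousAt).continuousWithinAt
    have hder : ∀ s ∈ Ico x y, HasDerivWithinAt (fun s => (lam s ^ 2)⁻¹ + 2 * a * s) 0 (Ici s) s :=
      fun s hs => (hφ' s (hsub (Ico_subset_Icc_self hs))).hasDerivWithinAt
    exact constant_of_has_deriv_right_zero hcont hder y (right_mem_Icc.2 hxy)
  have hφeq : (lam t ^ 2)⁻¹ + 2 * a * t = (lam t₀ ^ 2)⁻¹ + 2 * a * t₀ := by
    rcases le_total t₀ t with h | h
    · exact key t₀ t ht₀ ht h
    · exact (key t t₀ ht ht₀ h).symm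
  linarith

/-- **Pinned blow-up ⇒ Leray's clock.** If on `(T₀, T)` the clock `λ` is differentiable,
non-vanishing, has constant readout `λ′ = aλ³`, and BLOWS UP at `T` (`λ → +∞` as `t ↑ T`), then
`a > 0` and `(λ(t)²)⁻¹ = 2a(T − t)` on `(T₀, T)` (let `t ↑ T` in the affine law). [folklore] -/
theorem inv_sq_eq_leray_of_readout_eq (hT : T₀ < T) (hlam : ∀ t ∈ Ioo T₀ T, HasDerivAt lam (lam' t) t)
    (hne : ∀ t ∈ Ioo T₀ T, lam t ≠ 0) (ha : ∀ t ∈ Ioo T₀ T, lam' t = a * lam t ^ 3)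
    (hblow : Tendsto lam (𝓝[<] T) atTop) {t₀ : ℝ} (ht₀ : t₀ ∈ Ioo T₀ T) :
    0 < a ∧ (lam t₀ ^ 2)⁻¹ = 2 * a * (T - t₀) := by
  have hOC : (Ioo T₀ T).OrdConnected := ordConnected_Ioo
  have hev : ∀ᶠ t in 𝓝[<] T, (lam t ^ 2)⁻¹ = (lam t₀ ^ 2)⁻¹ - 2 * a * (t - t₀) := by
    filter_upwards [Ioo_mem_nhdsLT hT] with t ht
    exact inv_sq_eq_of_readout_eq hOC hlam hne ha ht ht₀
  have hL : Tendsto (fun t => (lam t ^ 2)⁻¹) (𝓝[<] T) (𝓝 0) :=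
    tendsto_inv_atTop_zero.comp ((tendsto_pow_atTop two_ne_zero).comp hblow)
  have hR : Tendsto (fun t => (lam t₀ ^ 2)⁻¹ - 2 * a * (t - t₀)) (𝓝[<] T)
      (𝓝 ((lam t₀ ^ 2)⁻¹ - 2 * a * (T - t₀))) :=
    ((by fun_prop : Continuous fun t : ℝ => (lam t₀ ^ 2)⁻¹ - 2 * a * (t - t₀)).tendsto T).mono_left
      nhdsWithin_le_nhds
  have hlim := tendsto_nhds_unique (hL.congr' hev) hR
  have hl0 : lam t₀ ≠ 0 := hne t₀ ht₀
  have hsq : 0 < (lam t₀ ^ 2)⁻¹ := by positivity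
  have hTt : 0 < T - t₀ := sub_pos.2 ht₀.2
  exact ⟨by nlinarith, by linarith⟩

/-- **The clock itself**: under the hypotheses of `inv_sq_eq_leray_of_readout_eq` and `λ > 0`,
`λ(t) = (√(2a(T−t)))⁻¹` on `(T₀, T)` — Leray's scale factor (Leray 1934 (3.12)). [folklore] -/
theorem eq_lerayScale_of_readout_eq (hT : T₀ < T) (hlam : ∀ t ∈ Ioo T₀ T, HasDerivAt lam (lam' t) t)
    (hpos : ∀ t ∈ Ioo T₀ T, 0 < lam t) (ha : ∀ t ∈ Ioo T₀ T, lam' t = a * lam t ^ 3)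
    (hblow : Tendsto lam (𝓝[<] T) atTop) {t : ℝ} (ht : t ∈ Ioo T₀ T) :
    lam t = (Real.sqrt (2 * a * (T - t)))⁻¹ := by
  have hne : ∀ s ∈ Ioo T₀ T, lam s ≠ 0 := fun s hs => (hpos s hs).ne'
  obtain ⟨-, h⟩ := inv_sq_eq_leray_of_readout_eq hT hlam hne ha hblow ht
  have h2 : lam t ^ 2 = (2 * a * (T - t))⁻¹ := by rw [← h, inv_inv]
  rw [← Real.sqrt_inv, ← h2, Real.sqrt_sq (hpos t ht).le]

end Clock

/-! ### §5 Headline: an exact one-profile modulated collapse is Leray's, or trivial -/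

section Headline

variable {E : Type*} [NormedAddCommGroup E] [InnerProductSpace ℝ E] [FiniteDimensional ℝ E]
variable {U : E → E} {P : E → ℝ} {lam lam' : ℝ → ℝ} {ν T₀ T : ℝ}

omit [FiniteDimensional ℝ E] in
/-- **The ansatz IS Leray's backward field** as soon as the clock is Leray's:
`u(t) = lerayBackward a T U t` (same profile, Leray 1934 (3.12)); so in the non-trivial branch of
`modulatedCollapse_rigidity` every exclusion of the census for Leray's ansatz (Nečas–Růžička–Šverák,
Tsai: tree `necas_ruzicka_sverak_holds`, `tsai_selfsimilar_holds`) applies verbatim. [folklore] -/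
theorem nsRescaleData_eq_lerayBackward {a t : ℝ} (h : lam t = (Real.sqrt (2 * a * (T - t)))⁻¹) :
    nsRescaleData (lam t) U = lerayBackward a T U t := by
  funext x
  rw [nsRescaleData_apply, lerayBackward_apply, h]

/-! Standing hypotheses of the headline theorems: `T₀ < T`; on `(T₀, T)` the clock `λ` is
differentiable with derivative `λ′`, positive, and blows up at `T`; `U ∈ C¹(E; E)`; and
`u(t, x) = λ(t) • U(λ(t) • x)`, `p(t, x) = λ(t)² P(λ(t) • x)` satisfy
`∂ₜu + (u·∇)u + ∇p − νΔu = 0` at every point of `(T₀, T) × E` (`ν : ℝ` of any sign, `0` allowed). -/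
variable (hT : T₀ < T) (hlam : ∀ t ∈ Ioo T₀ T, HasDerivAt lam (lam' t) t)
  (hpos : ∀ t ∈ Ioo T₀ T, 0 < lam t) (hblow : Tendsto lam (𝓝[<] T) atTop) (hU : ContDiff ℝ 1 U)
  (heq : ∀ t ∈ Ioo T₀ T, ∀ x : E,
    timeDeriv (fun s => nsRescaleData (lam s) U) t x +
        convect (nsRescaleData (lam t) U) (nsRescaleData (lam t) U) x +
        gradient (fun y => lam t ^ 2 * P (lam t • y)) x -
        ν • (Δ (nsRescaleData (lam t) U)) x = 0)
include hT hlam hpos hblow hU heq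

/-- **GAUGE RIGIDITY OF THE MODULATED ONE-PROFILE COLLAPSE.** Under the standing hypotheses,
EITHER `U ≡ 0` OR there is `a > 0` with `λ(t) = (2a(T−t))^{-1/2}` for all `t ∈ (T₀, T)`: the clock
of an exact one-profile collapse solving the Navier–Stokes (`ν ≠ 0`) or Euler (`ν = 0`) momentum
equation is Leray's, with no (logarithmic or other) correction, in every symmetry class. [folklore] -/
theorem modulatedCollapse_rigidity :
    U = 0 ∨ ∃ a : ℝ, 0 < a ∧ ∀ t ∈ Ioo T₀ T, lam t = (Real.sqrt (2 * a * (T - t)))⁻¹ := by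
  by_cases hU0 : U = 0
  · exact Or.inl hU0
  · right
    have hne : ∀ s ∈ Ioo T₀ T, lam s ≠ 0 := fun s hs => (hpos s hs).ne'
    obtain ⟨a, ha⟩ := exists_readout_eq_of_momentum hlam hne hU heq hU0
    obtain ⟨t₁, ht₁⟩ : (Ioo T₀ T).Nonempty := nonempty_Ioo.2 hT
    refine ⟨a, (inv_sq_eq_leray_of_readout_eq hT hlam hne ha hblow ht₁).1, fun t ht => ?_⟩
    exact eq_lerayScale_of_readout_eq hT hlam hpos ha hblow ht

/-- **No correction to the parabolic gauge.** If `U ≢ 0`, the «modulation relative to Leray»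
`(T − t) λ(t)²` is CONSTANT on `(T₀, T)` (`= (2a)⁻¹`). For the zone-Z7 gauge
`λ(t) = (T−t)^{-1/2} ℓ(t)` this says `ℓ² ≡ const`: a logarithmic factor `ℓ = (−log(T−t))^β`,
`β ≠ 0`, or any other non-constant correction, is impossible for an exact one-profile collapse.
[folklore] -/
theorem sub_mul_sq_eq_const (hU0 : U ≠ 0) :
    ∃ a : ℝ, 0 < a ∧ ∀ t ∈ Ioo T₀ T, (T - t) * lam t ^ 2 = (2 * a)⁻¹ := by
  rcases modulatedCollapse_rigidity hT hlam hpos hblow hU heq with h0 | ⟨a, ha, h⟩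
  · exact absurd h0 hU0
  · refine ⟨a, ha, fun t ht => ?_⟩
    have hTt : T - t ≠ 0 := (sub_pos.2 ht.2).ne'
    have harg : 0 < 2 * a * (T - t) := mul_pos (mul_pos two_pos ha) (sub_pos.2 ht.2)
    rw [h t ht, inv_pow, Real.sq_sqrt harg.le]
    field_simp

/-- **The collapse is Leray's field**: if `U ≢ 0` there is `a > 0` with
`u(t) = lerayBackward a T U t` for every `t ∈ (T₀, T)`. [folklore] -/
theorem exists_eq_lerayBackward (hU0 : U ≠ 0) :
    ∃ a : ℝ, 0 < a ∧ ∀ t ∈ Ioo T₀ T, nsRescaleData (lam t) U = lerayBackward a T U t := by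
  rcases modulatedCollapse_rigidity hT hlam hpos hblow hU heq with h0 | ⟨a, ha, h⟩
  · exact absurd h0 hU0
  · exact ⟨a, ha, fun t ht => nsRescaleData_eq_lerayBackward (h t ht)⟩

end Headline

end Summit.NavierStokesRegularity.FluidComputer.SelfSimilarCensus

end
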